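import Mathlib
import Summits.Ventures.PercRepro.TriangleCapStarFamilyListOffDeg
import Summits.Ventures.PercRepro.TriangleCapStarFamilyWitness

/-!
# PercRepro — THE STAR FAMILY WITH A SHORT LIST: THE WITNESS (p3, gen 57; part 350)

The graph `HSFL` of part 348 on `ℓ + 1 + (s − t)` vertices, `t = Rc + a (D − 1) + Q D + a`, is a graph of the band
(triangle-free, `s` edges, `w` of degree `s − t`, every off-degree `≤ D`, a non-neighbour of off-degree exactly `D`)
with `a` inside edges and the deficiency
`Σ_{v ≠ w} c(v) (D − c(v)) = (Rc + a)(D − Rc − a) + Σ_{ρ < Rc} (D − sh ρ) sh ρ` (the centre and the centre rows are the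
only vertices that can have `0 < c < D`), so by the deficiency identity of part 282 its band value is
`2 j + 2 t (D − 1) = t (t − 1) + 2 a + (Rc + a)(D − Rc − a) + Σ_{ρ < Rc} (D − sh ρ) sh ρ` (`starFamilyListWitness`):
one theorem for every star family with any pattern of short centre rows — `k` below a threshold needs `k + 1` of
them.  Axioms: standard.
-/
namespace PercRepro

namespace TriangleCap

namespace C047

open Finset

/-- The block sizes are at most `D`. -/
theorem kSFL_le_D (D a Rc : ℕ) (sh : ℕ → ℕ) (ρ : ℕ) : kSFL D a Rc sh ρ ≤ D := by
  unfold kSFL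
  split_ifs <;> omega

/-- The block size of a centre row is `D − 1 − sh ρ`. -/
theorem kSFL_centre_eq (D a Rc : ℕ) (sh : ℕ → ℕ) (ρ : ℕ) (hρ : ρ < Rc) : kSFL D a Rc sh ρ = D - 1 - sh ρ := by
  unfold kSFL
  rw [if_pos hρ]

/-- The block size of an outer row is `D − a`. -/
theorem kSFL_outer_eq (D a Rc : ℕ) (sh : ℕ → ℕ) (ρ : ℕ) (h1 : Rc ≤ ρ) (h2 : ρ < Rc + (D - 1)) :
    kSFL D a Rc sh ρ = D - a := by
  unfold kSFL
  rw [if_neg (by omega), if_pos h2]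

/-- Every off-degree of the star family is at most `D`. -/
theorem offSFL_le (ℓ D a Rc : ℕ) (sh : ℕ → ℕ) (E Q v : ℕ) (_ha : 1 ≤ a) (hRc : 1 ≤ Rc) (haR : a + Rc ≤ D)
    (hsh : ∀ ρ < Rc, sh ρ + 1 ≤ D) : offSFL ℓ D a Rc sh E Q v ≤ D := by
  have hD1 : 1 ≤ D := by
    have := hsh 0 (by omega)
    omega
  have hk := kSFL_le_D D a Rc sh (v - (ℓ + 1))
  unfold offSFL
  split_ifs <;> first
    | omega
    | (rw [kSFL_outer_eq D a Rc sh _ (by omega) (by omega)]; omega)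
    | (rw [kSFL_centre_eq D a Rc sh _ (by omega)]; omega)

/-- The special `1` has off-degree `D`. -/
theorem offSFL_one (ℓ D a Rc : ℕ) (sh : ℕ → ℕ) (E Q : ℕ) (ha : 1 ≤ a) : offSFL ℓ D a Rc sh E Q 1 = D := by
  unfold offSFL
  rw [if_neg (show ¬ (1 = 0) by omega), if_pos ha]

/-- The centre has off-degree `Rc + a`. -/
theorem offSFL_centre (ℓ D a Rc : ℕ) (sh : ℕ → ℕ) (E Q : ℕ) (ha : 1 ≤ a) : offSFL ℓ D a Rc sh E Q (a + Q + 1) = Rc + a := by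
  unfold offSFL
  rw [if_neg (show ¬ (a + Q + 1 = 0) by omega), if_neg (show ¬ (a + Q + 1 ≤ a) by omega),
    if_neg (show ¬ (a + Q + 1 ≤ a + Q) by omega), if_pos rfl]

/-- The centre row `ρ < Rc` has off-degree `D − sh ρ`. -/
theorem offSFL_row (ℓ D a Rc : ℕ) (sh : ℕ → ℕ) (E Q ρ : ℕ) (hρ : ρ < Rc) (hsh : ∀ ρ < Rc, sh ρ + 1 ≤ D)
    (hℓ : a + Q + 1 ≤ ℓ) : offSFL ℓ D a Rc sh E Q (ℓ + 1 + ρ) = D - sh ρ := by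
  unfold offSFL
  rw [if_neg (show ¬ (ℓ + 1 + ρ = 0) by omega), if_neg (show ¬ (ℓ + 1 + ρ ≤ a) by omega),
    if_neg (show ¬ (ℓ + 1 + ρ ≤ a + Q) by omega), if_neg (show ¬ (ℓ + 1 + ρ = a + Q + 1) by omega),
    if_neg (show ¬ (ℓ + 1 + ρ ≤ ℓ) by omega), if_pos (show ℓ + 1 + ρ < ℓ + 1 + Rc by omega),
    Nat.add_sub_cancel_left, kSFL_centre_eq D a Rc sh ρ hρ]
  have := hsh ρ hρ
  omega

/-- Every vertex other than `0`, the centre and the centre rows has off-degree `0` or `D`. -/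
theorem offSFL_zero_or (ℓ D a Rc : ℕ) (sh : ℕ → ℕ) (E Q v : ℕ) (_ha : 1 ≤ a) (hRc : 1 ≤ Rc) (haR : a + Rc ≤ D)
    (hsh : ∀ ρ < Rc, sh ρ + 1 ≤ D) (hvc : v ≠ a + Q + 1) (hvr : v < ℓ + 1 ∨ ℓ + 1 + Rc ≤ v) :
    offSFL ℓ D a Rc sh E Q v = 0 ∨ offSFL ℓ D a Rc sh E Q v = D := by
  have hD1 : 1 ≤ D := by
    have := hsh 0 (by omega)
    omega
  unfold offSFL
  split_ifs <;> first
    | omega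
    | (rw [kSFL_outer_eq D a Rc sh _ (by omega) (by omega)]; omega)

/-- **THE DEFICIENCY OF THE SHORT-LIST STAR FAMILY:**
`Σ_{v ≠ w} c(v) (D − c(v)) = (Rc + a)(D − Rc − a) + Σ_{ρ < Rc} (D − sh ρ) sh ρ`. -/
theorem sum_deficiency_HSFL (s ℓ t D a Rc : ℕ) (sh : ℕ → ℕ) (E Q : ℕ) (ha : 1 ≤ a) (hRc : 1 ≤ Rc) (haR : a + Rc ≤ D)
    (hsh : ∀ ρ < Rc, sh ρ + 1 ≤ D) (hQ : 1 ≤ Q) (hQ1 : D ≤ Q + 1) (hQE : 1 ≤ E → D ≤ Q)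
    (hinc : Rc * (D - 1) + (D - 1) * (D - a) + E * D = Q * D + ∑ ρ ∈ range Rc, sh ρ) (hℓ : a + Q + 1 ≤ ℓ)
    (hN : Rc + (D - 1) + E ≤ s - t) :
    ∑ v ∈ univ.erase (fin' (nSF s ℓ t) (nSF_pos s ℓ t) 0),
      offDeg (HSFL s ℓ t D a Rc sh E Q) (fin' (nSF s ℓ t) (nSF_pos s ℓ t) 0) v *
        (D - offDeg (HSFL s ℓ t D a Rc sh E Q) (fin' (nSF s ℓ t) (nSF_pos s ℓ t) 0) v) =
      (Rc + a) * (D - (Rc + a)) + ∑ ρ ∈ range Rc, (D - sh ρ) * sh ρ := by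
  have hC : a + Q + 1 < nSF s ℓ t := by
    unfold nSF
    omega
  have hrow : ∀ ρ ∈ range Rc, ℓ + 1 + ρ < nSF s ℓ t := by
    intro ρ hρ
    rw [mem_range] at hρ
    unfold nSF
    omega
  set f : Fin (nSF s ℓ t) → ℕ := fun v => offDeg (HSFL s ℓ t D a Rc sh E Q) (fin' (nSF s ℓ t) (nSF_pos s ℓ t) 0) v *
    (D - offDeg (HSFL s ℓ t D a Rc sh E Q) (fin' (nSF s ℓ t) (nSF_pos s ℓ t) 0) v) with hf
  set rows : Finset (Fin (nSF s ℓ t)) := (range Rc).image (fun ρ => fin' (nSF s ℓ t) (nSF_pos s ℓ t) (ℓ + 1 + ρ))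
    with hrows
  set S : Finset (Fin (nSF s ℓ t)) := insert (fin' (nSF s ℓ t) (nSF_pos s ℓ t) (a + Q + 1)) rows with hS
  -- the terms off `S` vanish
  have hoff : ∀ v ∈ univ.erase (fin' (nSF s ℓ t) (nSF_pos s ℓ t) 0), v ∉ S → f v = 0 := by
    intro v hv hvS
    rw [mem_erase] at hv
    rw [hS, mem_insert, hrows, mem_image] at hvS
    have hvv : v = fin' (nSF s ℓ t) (nSF_pos s ℓ t) v.val := Fin.ext (by rw [fin'_val _ _ _ v.isLt])
    have hvc : v.val ≠ a + Q + 1 := by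
      intro h
      apply hvS
      left
      rw [hvv, h]
    have hvr : v.val < ℓ + 1 ∨ ℓ + 1 + Rc ≤ v.val := by
      by_contra hcon
      rw [not_or, not_lt, not_le] at hcon
      apply hvS
      right
      refine ⟨v.val - (ℓ + 1), mem_range.mpr (by omega), ?_⟩
      rw [hvv]
      congr 1
      omega
    rw [hf]
    simp only
    rw [hvv, offDeg_HSFL s ℓ t D a Rc sh E Q ha hRc hsh hQ hQ1 hQE hinc hℓ hN v.val v.isLt]
    rcases offSFL_zero_or ℓ D a Rc sh E Q v.val ha hRc haR hsh hvc hvr with h | h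
    · rw [h, zero_mul]
    · rw [h, Nat.sub_self, mul_zero]
  have hS0 : S ⊆ univ.erase (fin' (nSF s ℓ t) (nSF_pos s ℓ t) 0) := by
    intro v hv
    rw [mem_erase]
    refine ⟨?_, mem_univ _⟩
    rw [hS, mem_insert, hrows, mem_image] at hv
    rcases hv with rfl | ⟨ρ, hρ, rfl⟩
    · exact fin'_ne' _ _ _ _ hC (nSF_pos s ℓ t) (by omega)
    · exact fin'_ne' _ _ _ _ (hrow ρ hρ) (nSF_pos s ℓ t) (by omega)
  rw [← sum_subset hS0 (fun v hv hvS => hoff v hv hvS)]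
  have hcS : fin' (nSF s ℓ t) (nSF_pos s ℓ t) (a + Q + 1) ∉ rows := by
    rw [hrows, mem_image]
    rintro ⟨ρ, hρ, h⟩
    have := congrArg Fin.val h
    rw [fin'_val _ _ _ (hrow ρ hρ), fin'_val _ _ _ hC] at this
    omega
  have hinj : Set.InjOn (fun ρ => fin' (nSF s ℓ t) (nSF_pos s ℓ t) (ℓ + 1 + ρ)) ↑(range Rc) := by
    intro ρ hρ ρ' hρ' h
    have := congrArg Fin.val h
    rw [fin'_val _ _ _ (hrow ρ hρ), fin'_val _ _ _ (hrow ρ' hρ')] at this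
    omega
  rw [hS, sum_insert hcS, hrows, sum_image hinj]
  congr 1
  · rw [hf]
    simp only
    rw [offDeg_HSFL s ℓ t D a Rc sh E Q ha hRc hsh hQ hQ1 hQE hinc hℓ hN (a + Q + 1) hC,
      offSFL_centre ℓ D a Rc sh E Q ha]
  · apply sum_congr rfl
    intro ρ hρ
    rw [hf]
    simp only
    rw [offDeg_HSFL s ℓ t D a Rc sh E Q ha hRc hsh hQ hQ1 hQE hinc hℓ hN (ℓ + 1 + ρ) (hrow ρ hρ),
      offSFL_row ℓ D a Rc sh E Q ρ (mem_range.mp hρ) hsh hℓ]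
    have := hsh ρ (mem_range.mp hρ)
    have e : D - (D - sh ρ) = sh ρ := by omega
    rw [e]

/-- **THE ATTACHMENT OF THE STAR FAMILY:** every cross pair ends at a leaf, the inside edges at none:
`attach = Rc + a (D − 1) + Q D`. -/
theorem attach_HSFL (s ℓ t D a Rc : ℕ) (sh : ℕ → ℕ) (E Q : ℕ) (ht : t = Rc + a * (D - 1) + Q * D + a) (ha : 1 ≤ a)
    (hRc : 1 ≤ Rc) (hsh : ∀ ρ < Rc, sh ρ + 1 ≤ D) (hQ : 1 ≤ Q) (hQ1 : D ≤ Q + 1) (hQE : 1 ≤ E → D ≤ Q)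
    (hinc : Rc * (D - 1) + (D - 1) * (D - a) + E * D = Q * D + ∑ ρ ∈ range Rc, sh ρ) (hℓ : a + Q + 1 ≤ ℓ)
    (hN : Rc + (D - 1) + E ≤ s - t) (hs : 2 * t ≤ s) :
    attach (HSFL s ℓ t D a Rc sh E Q) (fin' (nSF s ℓ t) (nSF_pos s ℓ t) 0) = Rc + a * (D - 1) + Q * D := by
  have hg := goodEnds_SFL (nSF s ℓ t) ℓ D a Rc sh E Q ha hRc hsh hQ hQ1 hQE hinc hℓ (by unfold nSF; omega)
  have hatt := attach_genWitness (nSF s ℓ t) (ℓ + 1) (s - a) (Rc + a * (D - 1) + Q * D) (nSF_pos s ℓ t)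
    (lfSF D a Rc Q) (rfSFL ℓ D a Rc sh E) hg (by omega) (by unfold nSF; omega)
  have hall : ((range (Rc + a * (D - 1) + Q * D)).filter
      (fun i => rfSFL ℓ D a Rc sh E i < ℓ + 1 + (s - a - (Rc + a * (D - 1) + Q * D)))).card =
      Rc + a * (D - 1) + Q * D := by
    rw [filter_true_of_mem (fun i hi => by
      have := rfSFL_bounds ℓ D a Rc sh E Q i ha hRc hsh hinc (mem_range.mp hi)
      omega), card_range]
  have hsame : attach (HSFL s ℓ t D a Rc sh E Q) (fin' (nSF s ℓ t) (nSF_pos s ℓ t) 0) =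
      attach (H0SFL s ℓ t D a Rc sh E Q) (fin' (nSF s ℓ t) (nSF_pos s ℓ t) 0) := by
    unfold attach
    apply sum_congr
    · apply filter_congr
      intro v _
      exact addEdges_adj_of_notMem _ _ _ (SSF_zero s ℓ t a Q hℓ) v
    intro v hv
    rw [mem_filter] at hv
    rw [offDeg_addEdges _ _ (SSF_nondiag s ℓ t a Q hℓ) (SSFL_new s ℓ t D a Rc sh E Q hℓ) _
      (SSF_zero s ℓ t a Q hℓ) v]
    have hv' : ℓ + 1 ≤ v.val := by
      by_contra hcon
      rw [not_le] at hcon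
      exact not_adj_H0SFL_left s ℓ t D a Rc sh E Q _ v (by rw [fin'_val _ _ 0 (nSF_pos s ℓ t)]; omega) hcon
        hv.2
    have hzero : ((SSF s ℓ t a Q).filter (fun e => v ∈ e)).card = 0 := by
      rw [card_eq_zero, filter_eq_empty_iff]
      intro e he hve
      have := SSF_ends s ℓ t a Q hℓ e he v hve
      omega
    rw [hzero, add_zero]
  rw [hsame, hatt, hall]

/-- **THE SHORT-LIST STAR FAMILY WITNESS:** for `1 ≤ a`, `1 ≤ Rc`, `a + Rc ≤ D`, `sh ρ < D`, `D − 1 ≤ Q` (and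
`D ≤ Q` when there are extra rows), the incidence identity `Rc (D − 1) + (D − 1)(D − a) + E D = Q D + Σ_{ρ<Rc} sh ρ`,
`a + Q + 1 ≤ ℓ` non-neighbours and `2 t ≤ s` with `t = Rc + a (D − 1) + Q D + a`: a triangle-free graph on
`ℓ + 1 + (s − t)` vertices with `s` edges, a vertex `w` of degree `s − t`, every off-degree `≤ D`, a non-neighbour
of off-degree exactly `D`, and the band value
`2 j + 2 t (D − 1) = t (t − 1) + 2 a + (Rc + a)(D − Rc − a) + Σ_{ρ < Rc} (D − sh ρ) sh ρ`. -/
theorem starFamilyListWitness (s ℓ t D a Rc : ℕ) (sh : ℕ → ℕ) (E Q : ℕ) (ht : t = Rc + a * (D - 1) + Q * D + a) (ha : 1 ≤ a)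
    (hRc : 1 ≤ Rc) (haR : a + Rc ≤ D) (hsh : ∀ ρ < Rc, sh ρ + 1 ≤ D) (hQ : 1 ≤ Q) (hQ1 : D ≤ Q + 1)
    (hQE : 1 ≤ E → D ≤ Q) (hinc : Rc * (D - 1) + (D - 1) * (D - a) + E * D = Q * D + ∑ ρ ∈ range Rc, sh ρ)
    (hℓ : a + Q + 1 ≤ ℓ) (hs : 2 * t ≤ s) :
    ∃ (H : SimpleGraph (Fin (ℓ + 1 + (s - t)))) (_ : DecidableRel H.Adj), H.CliqueFree 3 ∧
      H.edgeFinset.card = s ∧ ∃ w, deg H w + t = s ∧ (∀ v, offDeg H w v ≤ D) ∧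
        (∃ x, ¬ H.Adj w x ∧ offDeg H w x = D) ∧
        ∃ j, ∑ v, deg H v * deg H v + 2 * (t * (s - t - 1)) + 2 * j = s * (s + 1) ∧
          2 * j + 2 * (t * (D - 1)) =
            t * (t - 1) + 2 * a + ((Rc + a) * (D - (Rc + a)) + ∑ ρ ∈ range Rc, (D - sh ρ) * sh ρ) := by
  -- the rows fit among the leaves: `E ≤ Q` by the incidence identity, so `Rc + (D − 1) + E ≤ t ≤ s − t`
  have hD1 : 1 ≤ D := by
    have := hsh 0 (by omega)
    omega
  have hEQ : E ≤ Q := by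
    have hsum : ∑ ρ ∈ range Rc, sh ρ ≤ Rc * (D - 1) := by
      calc ∑ ρ ∈ range Rc, sh ρ ≤ ∑ _ρ ∈ range Rc, (D - 1) :=
            sum_le_sum (fun ρ hρ => by have := hsh ρ (mem_range.mp hρ); omega)
        _ = Rc * (D - 1) := by rw [sum_const, card_range, smul_eq_mul]
    have h1 : E * D ≤ Q * D := by omega
    exact Nat.le_of_mul_le_mul_right h1 (by omega)
  have hN : Rc + (D - 1) + E ≤ s - t := by
    have h1 : D - 1 ≤ a * (D - 1) := Nat.le_mul_of_pos_left (D - 1) ha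
    have h2 : Q ≤ Q * D := Nat.le_mul_of_pos_right Q (by omega)
    omega
  have hD0 : 0 < D := by omega
  have hfree := cliqueFree_HSFL s ℓ t D a Rc sh E Q ha hRc hsh hQ hQ1 hQE hinc hℓ hN
  have hcard := card_edges_HSFL s ℓ t D a Rc sh E Q ht ha hRc hsh hQ hQ1 hQE hinc hℓ hN hs
  have hdeg := deg_HSFL_zero s ℓ t D a Rc sh E Q ht ha hRc hsh hQ hQ1 hQE hinc hℓ hN hs
  have hDle : ∀ v, offDeg (HSFL s ℓ t D a Rc sh E Q) (fin' (nSF s ℓ t) (nSF_pos s ℓ t) 0) v ≤ D := by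
    intro v
    have hvv : v = fin' (nSF s ℓ t) (nSF_pos s ℓ t) v.val := Fin.ext (by rw [fin'_val _ _ _ v.isLt])
    rw [hvv, offDeg_HSFL s ℓ t D a Rc sh E Q ha hRc hsh hQ hQ1 hQE hinc hℓ hN v.val v.isLt]
    exact offSFL_le ℓ D a Rc sh E Q v.val ha hRc haR hsh
  have ht1 : 1 ≤ t := by omega
  have hw1 : 1 ≤ deg (HSFL s ℓ t D a Rc sh E Q) (fin' (nSF s ℓ t) (nSF_pos s ℓ t) 0) := by
    rw [hdeg]
    omega
  obtain ⟨j, -, hj⟩ := sum_deg_sq_layer (HSFL s ℓ t D a Rc sh E Q) hfree (fin' (nSF s ℓ t) (nSF_pos s ℓ t) 0) hw1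
  have hoff : (offEdges (HSFL s ℓ t D a Rc sh E Q) (fin' (nSF s ℓ t) (nSF_pos s ℓ t) 0)).card = t := by
    have := card_offEdges_add_deg (HSFL s ℓ t D a Rc sh E Q) (fin' (nSF s ℓ t) (nSF_pos s ℓ t) 0)
    rw [hdeg, hcard] at this
    omega
  rw [hoff, hdeg, hcard] at hj
  refine ⟨HSFL s ℓ t D a Rc sh E Q, inferInstance, hfree, hcard, fin' (nSF s ℓ t) (nSF_pos s ℓ t) 0, ?_, hDle,
    ?_, j, hj, ?_⟩
  · rw [hdeg]
    omega
  · refine ⟨fin' (nSF s ℓ t) (nSF_pos s ℓ t) 1, ?_, ?_⟩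
    · rw [addEdges_adj_of_notMem _ _ _ (SSF_zero s ℓ t a Q hℓ)]
      exact not_adj_genWitness_one (nSF s ℓ t) (ℓ + 1) (s - a) (Rc + a * (D - 1) + Q * D) (nSF_pos s ℓ t)
        (lfSF D a Rc Q) (rfSFL ℓ D a Rc sh E) (by omega) (by unfold nSF; omega)
    · rw [offDeg_HSFL s ℓ t D a Rc sh E Q ha hRc hsh hQ hQ1 hQE hinc hℓ hN 1 (by unfold nSF; omega)]
      exact offSFL_one ℓ D a Rc sh E Q ha
  · have hdef := deficiency_identity (HSFL s ℓ t D a Rc sh E Q) hfree s t j D hcard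
      (fin' (nSF s ℓ t) (nSF_pos s ℓ t) 0) (by rw [hdeg]; omega) hw1 hj hDle
    have hins : (insideEdges (HSFL s ℓ t D a Rc sh E Q) (fin' (nSF s ℓ t) (nSF_pos s ℓ t) 0)).card = a := by
      have h1 := attach_add_card_inside (HSFL s ℓ t D a Rc sh E Q) hfree (fin' (nSF s ℓ t) (nSF_pos s ℓ t) 0)
      rw [attach_HSFL s ℓ t D a Rc sh E Q ht ha hRc hsh hQ hQ1 hQE hinc hℓ hN hs, hoff] at h1
      omega
    rw [hdef, hins, sum_deficiency_HSFL s ℓ t D a Rc sh E Q ha hRc haR hsh hQ hQ1 hQE hinc hℓ hN]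

end C047

end TriangleCap

end PercRepro
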